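import Literature.Analysis.FluidPDE.LocalLerayInitialPairing
import Literature.Analysis.FluidPDE.LocalLeraySlabCubicIntegrability
import Literature.Analysis.FluidPDE.LocalTypeILscGradientTools
import Literature.Analysis.FluidPDE.NSSuitableESSProofs
import HarnessLib

/-!
# Local Leray solutions on a slab: the pairing with a test field from the initial time, with
the viscous term in gradient form

Analysis/FluidPDE theorem file (no new definitions) over the slab class
`IsLocalLeraySolutionOn T ν v₀ v π` (`LocalLeraySolutionsSlab.lean`: Kang–Miura–Tsai 2021,
Def. 3.2 on `(0,T)` = Lemarié-Rieusset 2016, Def. 14.1), first file of the weak–strong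
ingredient of Lemarié-Rieusset 2016, Thm. 14.7 (the balance of `u₁·u₂`, file p. 515, obtained by
testing each solution's equation against the other solution): the one-solution identities that
the time-doubling argument consumes.

* `HasWeakSpatialGradientOn.integral_inner_laplacian_eq_neg_sum` — **the viscous term in gradient
  form**: for a weak spatial gradient `G` of `u` on `Q` and a vector test field `ψ ∈ C_c^∞(Q; E)`,
  `∫∫ ⟪u, Δψ⟫ = -∫∫ ∑ᵢ ⟪G eᵢ, ∂ᵢψ⟫` (`= -∫∫ ∇u : ∇ψ`; Caffarelli–Kohn–Nirenberg 1982, (2.1):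
  the defining identity of the weak gradient, applied to the coordinates `⟪∂ᵢψ, eⱼ⟫` and summed
  over an orthonormal frame);
* `IsLocalLeraySolutionOn.ae_integral_inner_laplacian_slice` — its sliced form: for a fixed
  `φ ∈ C_c^∞(E; E)` and a.e. `t ∈ (0,T)`, `∫ ⟪v(t), Δφ⟫ = -∫ ∑ᵢ ⟪G(t) eᵢ, ∂ᵢφ⟫` (test with
  `η(t)φ(x)`, Fubini, fundamental lemma of the calculus of variations);
* `IsLocalLeraySolutionOn.ae_pairing_eq_datum_add` — **the pairing identity from the initial
  time at a.e. slice** (Lemarié-Rieusset 2016, Prop. 14.1, first step; Robinson–Rodrigo–Sadowski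
  2016, (3.1)/Lemma 3.7): for a local Leray solution on `(0,T) × ℝ³` with measurable datum `v₀`,
  every `φ ∈ C_c^∞(ℝ³; ℝ³)` and a.e. `t ∈ (0,T)`,
  `⟨v(t), φ⟩ = ⟨v₀, φ⟩ + ∫₀ᵗ∫ (⟪v, (v·∇)φ⟫ + ν⟪v, Δφ⟫ + π div φ)` (the slab form of the accepted
  `IsLocalLeraySolution.ae_pairing_eq_datum_add`, any `ν`);
* `IsLocalLeraySolutionOn.ae_pairing_eq_datum_add_grad` — the same with the viscous term in
  gradient form, `… - ν ∫₀ᵗ∫ ∑ᵢ ⟪G eᵢ, ∂ᵢφ⟫ …`, for any weak spatial gradient `G` of `v` on the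
  slab (the form that extends to `H¹` test fields).

## Mathlib / tree search

Tree: `BradshawTsai2019.ae_pairing_eq_datum_add_setIntegral`, `integrable_slab_inner`,
`integrable_slab_inner_clm_apply`, `integrable_slab_mul` (`LocalLerayInitialPairing`,
`DistributionalToWeak`); `setIntegral_mul_inner_weakGradient_eq`, `locallyIntegrableOn_inner_apply`
(`LocalTypeILscGradientTools`); `IsSpaceTimeTestOn.fderiv_apply_top`,
`IsSpaceTimeTestOn.fderiv_slice_eq_zero_of_notMem`, `isSpaceTimeTestOn_slab_smul`,
`integrable_inner_of_locallyIntegrableOn`, `IsLocalLeraySolutionOn.integrableOn_velocity`,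
`.integrableOn_pressure`, `ae_slice_aestronglyMeasurable_and_lintegral_ball_lt_top`. Mathlib:
`InnerProductSpace.laplacian_eq_iteratedFDeriv_orthonormalBasis`, `iteratedFDeriv_two_apply`,
`OrthonormalBasis.sum_inner_mul_inner`, `fderiv_inner_apply`,
`IsOpen.ae_eq_zero_of_integral_contDiff_smul_eq_zero`.

## References

* P. G. Lemarié-Rieusset, *The Navier–Stokes Problem in the 21st Century*, CRC Press 2016,
  doi:10.1201/b19556: Prop. 14.1 (p. 498); Thm. 14.7, proof, p. 515. [LemarieRieusset2016]
* J. C. Robinson, J. L. Rodrigo, W. Sadowski, *The Three-Dimensional Navier–Stokes Equations*,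
  CUP 2016, §3.1 (3.1), Lemma 3.7. [RobinsonRodrigoSadowski2016]
* L. Caffarelli, R. Kohn, L. Nirenberg, Comm. Pure Appl. Math. 35 (1982), §2, (2.1).
  [CaffarelliKohnNirenberg1982]
-/

noncomputable section

open MeasureTheory TopologicalSpace Set Function Filter Metric
open _root_.Topology
open scoped ENNReal NNReal RealInnerProductSpace Laplacian

namespace Literature.Analysis.FluidPDE

open BradshawTsai2019

section WeakGradientLaplacian

variable {E : Type*} [NormedAddCommGroup E] [InnerProductSpace ℝ E] [FiniteDimensional ℝ E]
  [MeasurableSpace E] [BorelSpace E]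

omit [MeasurableSpace E] [BorelSpace E] in
/-- `Δψ(x) = ∑ᵢ ∂ᵢ∂ᵢψ(x)` over an orthonormal frame, for a `C²` field (restated locally from
Mathlib's `laplacian_eq_iteratedFDeriv_orthonormalBasis`). [folklore] -/
theorem laplacian_eq_sum_fderiv_fderiv_apply {ι : Type*} [Fintype ι] (b : OrthonormalBasis ι ℝ E)
    {F : Type*} [NormedAddCommGroup F] [NormedSpace ℝ F] {ψ : E → F} (hψ : ContDiff ℝ 2 ψ)
    (x : E) : (Δ ψ) x = ∑ i, fderiv ℝ (fun y => fderiv ℝ ψ y (b i)) x (b i) := by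
  rw [InnerProductSpace.laplacian_eq_iteratedFDeriv_orthonormalBasis ψ b]
  refine Finset.sum_congr rfl fun i _ => ?_
  have hd : DifferentiableAt ℝ (fderiv ℝ ψ) x :=
    ((hψ.fderiv_right (m := 1) le_rfl).differentiable one_ne_zero) x
  rw [iteratedFDeriv_two_apply, fderiv_clm_apply hd (differentiableAt_const _)]
  simp

omit [FiniteDimensional ℝ E] [MeasurableSpace E] [BorelSpace E] in
/-- The scalar coordinates `(t,x) ↦ ⟪∂ₐψ(t,·)(x), c⟫` of the spatial derivative of a vector
test field on `Q` are scalar space–time test functions on `Q`. [folklore] -/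
theorem IsSpaceTimeTestOn.inner_fderiv_apply_const {Q : Opens (ℝ × E)} {ψ : ℝ → E → E}
    (hψ : IsSpaceTimeTestOn Q ψ) (a c : E) :
    IsSpaceTimeTestOn Q (fun t x => ⟪fderiv ℝ (ψ t) x a, c⟫) := by
  have hd : IsSpaceTimeTestOn (⊤ : Opens (ℝ × E)) (fun t x => fderiv ℝ (ψ t) x a) :=
    (hψ.mono le_top).fderiv_apply_top a
  have hsub : tsupport (uncurry fun t x => ⟪fderiv ℝ (ψ t) x a, c⟫) ⊆ tsupport (uncurry ψ) := by
    refine closure_minimal (fun q hq => ?_) (isClosed_tsupport _)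
    obtain ⟨t', x'⟩ := q
    by_contra hq'
    exact hq (by simp [IsSpaceTimeTestOn.fderiv_slice_eq_zero_of_notMem hq'])
  refine ⟨?_, ?_, hsub.trans hψ.tsupport_subset⟩
  · have e : (uncurry fun t x => ⟪fderiv ℝ (ψ t) x a, c⟫) =
        fun p => ⟪uncurry (fun t x => fderiv ℝ (ψ t) x a) p, c⟫ := by
      funext p; rfl
    rw [e]
    exact hd.contDiff.inner ℝ contDiff_const
  · exact HasCompactSupport.intro hψ.hasCompactSupport fun p hp => by
      obtain ⟨t, x⟩ := p
      simp [IsSpaceTimeTestOn.fderiv_slice_eq_zero_of_notMem hp]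

/-- **The viscous term in gradient form** (Caffarelli–Kohn–Nirenberg 1982, (2.1): `∇u` in the
sense of distributions; here its consequence `∫∫ ⟪u, Δψ⟫ = -∫∫ ∇u : ∇ψ`). If `G` is a weak
spatial gradient of `u` on the open `Q ⊆ ℝ × E` and `ψ ∈ C_c^∞(Q; E)` is a vector test field,
then, with `(eᵢ)` the standard orthonormal frame of `E`,
`∫ ⟪u, Δψ⟫ = -∫ ∑ᵢ ⟪G eᵢ, ∂ᵢψ⟫` (integrals over `ℝ × E`). Proof: `⟪u, Δψ⟫ = ∑ᵢⱼ ∂ᵢ(⟪∂ᵢψ, eⱼ⟫) ⟪u, eⱼ⟫`,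
the defining identity of the weak gradient for the scalar tests `⟪∂ᵢψ, eⱼ⟫`, and
`∑ⱼ ⟪∂ᵢψ, eⱼ⟫⟪G eᵢ, eⱼ⟫ = ⟪G eᵢ, ∂ᵢψ⟫`. [cite: CaffarelliKohnNirenberg1982, §2 (2.1)] -/
theorem HasWeakSpatialGradientOn.integral_inner_laplacian_eq_neg_sum {Q : Opens (ℝ × E)}
    {u : ℝ → E → E} {G : ℝ → E → E →L[ℝ] E} (hG : HasWeakSpatialGradientOn Q u G)
    {ψ : ℝ → E → E} (hψ : IsSpaceTimeTestOn Q ψ) :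
    ∫ z : ℝ × E, ⟪u z.1 z.2, Δ (ψ z.1) z.2⟫ =
      -∫ z : ℝ × E, ∑ i, ⟪G z.1 z.2 (stdOrthonormalBasis ℝ E i),
        fderiv ℝ (ψ z.1) z.2 (stdOrthonormalBasis ℝ E i)⟫ := by
  set b := stdOrthonormalBasis ℝ E with hb
  set K : Set (ℝ × E) := tsupport (uncurry ψ) with hKdef
  have hK : IsCompact K := hψ.hasCompactSupport
  have hKQ : K ⊆ (Q : Set (ℝ × E)) := hψ.tsupport_subset
  have hψ2 : ∀ t, ContDiff ℝ 2 (ψ t) := fun t => contDiff_infty.1 (hψ.contDiff_slice t) 2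
  have hψd : ∀ t, Differentiable ℝ (ψ t) := fun t => (hψ.contDiff_slice t).differentiable (by simp)
  -- the scalar tests `θ i j = ⟪∂ᵢψ, eⱼ⟫`
  set θ : _ → _ → ℝ → E → ℝ := fun i j t x => ⟪fderiv ℝ (ψ t) x (b i), b j⟫ with hθ
  have hθtest : ∀ i j, IsSpaceTimeTestOn Q (θ i j) := fun i j =>
    hψ.inner_fderiv_apply_const (b i) (b j)
  have hθsub : ∀ i j, tsupport (uncurry (θ i j)) ⊆ K := by
    intro i j
    refine closure_minimal (fun q hq => ?_) (isClosed_tsupport _)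
    obtain ⟨t', x'⟩ := q
    by_contra hq'
    exact hq (by simp [hθ, IsSpaceTimeTestOn.fderiv_slice_eq_zero_of_notMem hq'])
  -- the derivative field `∂ᵢψ` as a space–time test field on `⊤`
  have hdψ : ∀ i, IsSpaceTimeTestOn (⊤ : Opens (ℝ × E)) (fun t x => fderiv ℝ (ψ t) x (b i)) :=
    fun i => (hψ.mono le_top).fderiv_apply_top (b i)
  have hdψd : ∀ i t, Differentiable ℝ (fun x => fderiv ℝ (ψ t) x (b i)) := fun i t =>
    ((hdψ i).contDiff_slice t).differentiable (by simp)
  -- pointwise: the coordinates of `∂ᵢ∂ᵢψ`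
  have hcoord : ∀ i j t x, fderiv ℝ (θ i j t) x (b i) =
      ⟪fderiv ℝ (fun y => fderiv ℝ (ψ t) y (b i)) x (b i), b j⟫ := by
    intro i j t x
    simp only [hθ]
    rw [fderiv_inner_apply ℝ ((hdψd i t) x) (differentiableAt_const _)]
    simp [fderiv_const_apply]
  -- pointwise: `⟪u, Δψ⟫ = ∑ᵢ ∑ⱼ ∂ᵢ(θ i j) ⟪u, eⱼ⟫`
  have hpt : ∀ z : ℝ × E, ⟪u z.1 z.2, Δ (ψ z.1) z.2⟫ =
      ∑ i, ∑ j, fderiv ℝ (θ i j z.1) z.2 (b i) * ⟪u z.1 z.2, b j⟫ := by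
    intro z
    rw [laplacian_eq_sum_fderiv_fderiv_apply b (hψ2 z.1) z.2, inner_sum]
    refine Finset.sum_congr rfl fun i _ => ?_
    rw [real_inner_comm, ← b.sum_inner_mul_inner (fderiv ℝ (fun y => fderiv ℝ (ψ z.1) y (b i)) z.2 (b i))
      (u z.1 z.2)]
    refine Finset.sum_congr rfl fun j _ => ?_
    rw [hcoord i j z.1 z.2, real_inner_comm (b j) (u z.1 z.2)]
  -- pointwise: `∑ⱼ θ i j ⟪G eᵢ, eⱼ⟫ = ⟪G eᵢ, ∂ᵢψ⟫`
  have hpt' : ∀ z : ℝ × E, ∑ i, ⟪G z.1 z.2 (b i), fderiv ℝ (ψ z.1) z.2 (b i)⟫ =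
      ∑ i, ∑ j, θ i j z.1 z.2 * ⟪G z.1 z.2 (b i), b j⟫ := by
    intro z
    refine Finset.sum_congr rfl fun i _ => ?_
    rw [← b.sum_inner_mul_inner (G z.1 z.2 (b i)) (fderiv ℝ (ψ z.1) z.2 (b i))]
    refine Finset.sum_congr rfl fun j _ => ?_
    simp only [hθ]
    rw [real_inner_comm (b j) (fderiv ℝ (ψ z.1) z.2 (b i)), mul_comm]
  -- integrability of the individual terms
  have hi1 : ∀ i j, Integrable (fun z : ℝ × E => fderiv ℝ (θ i j z.1) z.2 (b i) * ⟪u z.1 z.2, b j⟫)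
      (volume : Measure (ℝ × E)) := by
    intro i j
    have hd : IsSpaceTimeTestOn (⊤ : Opens (ℝ × E)) (fun t x => fderiv ℝ (θ i j t) x (b i)) :=
      ((hθtest i j).mono le_top).fderiv_apply_top (b i)
    have h0 : ∀ z ∉ K, fderiv ℝ (θ i j z.1) z.2 (b i) • b j = 0 := by
      rintro ⟨t, x⟩ hz
      have hz' : (t, x) ∉ tsupport (uncurry (θ i j)) := fun h' => hz (hθsub i j h')
      simp [IsSpaceTimeTestOn.fderiv_slice_eq_zero_of_notMem hz']
    have h := integrable_inner_of_locallyIntegrableOn hG.locallyIntegrableOn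
      (w := fun z : ℝ × E => fderiv ℝ (θ i j z.1) z.2 (b i) • b j)
      (hd.contDiff.continuous.smul continuous_const) hK hKQ h0
    exact h.congr (ae_of_all _ fun z => by simp only [real_inner_smul_right])
  have hi2 : ∀ i j, Integrable (fun z : ℝ × E => θ i j z.1 z.2 * ⟪G z.1 z.2 (b i), b j⟫)
      (volume : Measure (ℝ × E)) := by
    intro i j
    have h0 : ∀ z ∉ K, uncurry (θ i j) z = 0 := by
      rintro ⟨t, x⟩ hz
      simp [hθ, IsSpaceTimeTestOn.fderiv_slice_eq_zero_of_notMem hz]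
    have h := integrable_mul_of_locallyIntegrableOn
      (locallyIntegrableOn_inner_apply hG.locallyIntegrableOn_grad (b i) (b j))
      (hθtest i j).contDiff.continuous hK hKQ h0
    exact h.congr (ae_of_all _ fun z => mul_comm _ _)
  -- the identity for each pair `(i, j)`
  have hij : ∀ i j, ∫ z : ℝ × E, fderiv ℝ (θ i j z.1) z.2 (b i) * ⟪u z.1 z.2, b j⟫ =
      -∫ z : ℝ × E, θ i j z.1 z.2 * ⟪G z.1 z.2 (b i), b j⟫ := by
    intro i j
    have h := setIntegral_mul_inner_weakGradient_eq hG (hθtest i j) (b i) (b j)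
    have hzero : ∀ w ∉ (Q : Set (ℝ × E)), θ i j w.1 w.2 * ⟪G w.1 w.2 (b i), b j⟫ = 0 := fun w hw => by
      rw [(hθtest i j).apply_eq_zero (t := w.1) (x := w.2) hw, zero_mul]
    rw [setIntegral_eq_integral_of_forall_compl_eq_zero hzero] at h
    rw [h, neg_neg]
  -- sum over `i, j`
  calc ∫ z : ℝ × E, ⟪u z.1 z.2, Δ (ψ z.1) z.2⟫
      = ∫ z : ℝ × E, ∑ i, ∑ j, fderiv ℝ (θ i j z.1) z.2 (b i) * ⟪u z.1 z.2, b j⟫ :=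
        integral_congr_ae (ae_of_all _ hpt)
    _ = ∑ i, ∑ j, ∫ z : ℝ × E, fderiv ℝ (θ i j z.1) z.2 (b i) * ⟪u z.1 z.2, b j⟫ := by
        rw [integral_finsetSum _ fun i _ => integrable_finsetSum _ fun j _ => hi1 i j]
        exact Finset.sum_congr rfl fun i _ => integral_finsetSum _ fun j _ => hi1 i j
    _ = ∑ i, ∑ j, -∫ z : ℝ × E, θ i j z.1 z.2 * ⟪G z.1 z.2 (b i), b j⟫ := by
        simp only [hij]
    _ = -∫ z : ℝ × E, ∑ i, ∑ j, θ i j z.1 z.2 * ⟪G z.1 z.2 (b i), b j⟫ := by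
        rw [integral_finsetSum _ fun i _ => integrable_finsetSum _ fun j _ => hi2 i j]
        simp only [Finset.sum_neg_distrib]
        rw [Finset.sum_congr rfl fun i _ => integral_finsetSum _ fun j _ => hi2 i j]
    _ = -∫ z : ℝ × E, ∑ i, ⟪G z.1 z.2 (b i), fderiv ℝ (ψ z.1) z.2 (b i)⟫ := by
        rw [integral_congr_ae (ae_of_all _ hpt')]

end WeakGradientLaplacian

namespace IsLocalLeraySolutionOn

variable {T ν : ℝ} {v₀ : EuclideanSpace ℝ (Fin 3) → EuclideanSpace ℝ (Fin 3)}
  {v : ℝ → EuclideanSpace ℝ (Fin 3) → EuclideanSpace ℝ (Fin 3)}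
  {π : ℝ → EuclideanSpace ℝ (Fin 3) → ℝ}

/-- **The pairing of a local Leray solution on a slab with a fixed test field, from the initial
time, at a.e. slice** (Lemarié-Rieusset 2016, Prop. 14.1, first step: "`t ↦ ∫ u(t,x)·φ(x) dx`
[...] `∂ₜ∫u·φ = ν∫u·Δφ + ∫u⊗u·∇⊗φ + ∫p div φ`"; Robinson–Rodrigo–Sadowski 2016, (3.1),
Lemma 3.7). For a local Leray solution `(v, π)` on `(0,T) × ℝ³`, `T > 0`, with measurable datum
`v₀`, every test field `φ ∈ C_c^∞(ℝ³; ℝ³)` and a.e. `t ∈ (0,T)`: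
`∫ ⟪v(t), φ⟫ = ∫ ⟪v₀, φ⟫ + ∫_{(0,t]} ∫ (⟪v, (v·∇)φ⟫ + ν ⟪v, Δφ⟫ + π div φ)`
(the accepted `BradshawTsai2019.ae_pairing_eq_datum_add_setIntegral` fed with the clauses of
the slab class). [cite: LemarieRieusset2016, Prop. 14.1 (file p. 498); RobinsonRodrigoSadowski2016 §3.1 (3.1)] -/
theorem ae_pairing_eq_datum_add (h : IsLocalLeraySolutionOn T ν v₀ v π) (hT : 0 < T)
    (hm₀ : AEStronglyMeasurable v₀ volume)
    {φ : EuclideanSpace ℝ (Fin 3) → EuclideanSpace ℝ (Fin 3)}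
    (hφ : FunctionSpaces.IsTestFunctionOn (⊤ : Opens (EuclideanSpace ℝ (Fin 3))) φ) :
    ∀ᵐ t ∂((volume : Measure ℝ).restrict (Ioo 0 T)),
      ∫ x, ⟪v t x, φ x⟫ = (∫ x, ⟪v₀ x, φ x⟫) +
        ∫ s in Ioc 0 t, ∫ x, (⟪v s x, convect (v s) φ x⟫ + ν * ⟪v s x, Δ φ x⟫ +
          π s x * VectorCalculus.divergence φ x) := by
  have hmeas : AEStronglyMeasurable (uncurry v)
      ((volume : Measure (ℝ × EuclideanSpace ℝ (Fin 3))).restrict (Ioo 0 T ×ˢ univ)) :=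
    h.aestronglyMeasurable
  have hsq : ∀ K : Set (EuclideanSpace ℝ (Fin 3)), IsCompact K →
      ∫⁻ z in Ioo 0 T ×ˢ K, ‖uncurry v z‖ₑ ^ 2 < ∞ := fun K hK => h.sqIntegrable K hK
  have hUK : ∀ K : Set (EuclideanSpace ℝ (Fin 3)), IsCompact K →
      IntegrableOn (uncurry v) (Ioo 0 T ×ˢ K) volume ∧
        IntegrableOn (fun z => ‖uncurry v z‖ ^ 2) (Ioo 0 T ×ˢ K) volume := fun K hK =>
    h.integrableOn_velocity hK
  have hpK : ∀ K : Set (EuclideanSpace ℝ (Fin 3)), IsCompact K →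
      IntegrableOn (uncurry π) (Ioo 0 T ×ˢ K) volume := fun K hK => h.integrableOn_pressure hK
  have hdist := h.distributional
  have hmom : ∀ ψ : ℝ → EuclideanSpace ℝ (Fin 3) → EuclideanSpace ℝ (Fin 3),
      IsSpaceTimeTestOn (slab (EuclideanSpace ℝ (Fin 3)) (Ioo 0 T) isOpen_Ioo) ψ →
      ∫ z in Ioo 0 T ×ˢ (univ : Set (EuclideanSpace ℝ (Fin 3))), (⟪v z.1 z.2, timeDeriv ψ z.1 z.2⟫ +
        ⟪v z.1 z.2, convect (v z.1) (ψ z.1) z.2⟫ + ν * ⟪v z.1 z.2, Δ (ψ z.1) z.2⟫ +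
        π z.1 z.2 * VectorCalculus.divergence (ψ z.1) z.2 +
        ⟪(0 : ℝ → EuclideanSpace ℝ (Fin 3) → EuclideanSpace ℝ (Fin 3)) z.1 z.2, ψ z.1 z.2⟫) = 0 :=
    fun ψ hψ => hdist.2.2.2.2 ψ hψ
  have hf : ∀ K : Set (EuclideanSpace ℝ (Fin 3)), IsCompact K →
      IntegrableOn (uncurry (0 : ℝ → EuclideanSpace ℝ (Fin 3) → EuclideanSpace ℝ (Fin 3)))
        (Ioo 0 T ×ˢ K) volume := fun K hK => integrableOn_zero
  have hgood := ae_slice_aestronglyMeasurable_and_lintegral_ball_lt_top hmeas hsq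
  have key := ae_pairing_eq_datum_add_setIntegral hT hUK hpK hmom hf hgood hm₀
    (fun K hK => h.initial K hK) hφ
  filter_upwards [key] with t ht
  simpa only [Pi.zero_apply, inner_zero_left, add_zero] using ht

/-- **The viscous pairing of a slice in gradient form, at a.e. time.** For a local Leray solution
on `(0,T) × ℝ³`, a weak spatial gradient `G` of `v` on the slab and `φ ∈ C_c^∞(ℝ³; ℝ³)`: for
a.e. `t ∈ (0,T)`, `∫ ⟪v(t), Δφ⟫ = -∫ ∑ᵢ ⟪G(t) eᵢ, ∂ᵢφ⟫` (test the space–time identity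
`integral_inner_laplacian_eq_neg_sum` with `η(t) φ(x)`, `η ∈ C_c^∞((0,T))`, Fubini, and the
fundamental lemma of the calculus of variations in `t`). [cite: CaffarelliKohnNirenberg1982, §2 (2.1)] -/
theorem ae_integral_inner_laplacian_slice (h : IsLocalLeraySolutionOn T ν v₀ v π)
    {G : ℝ → EuclideanSpace ℝ (Fin 3) → EuclideanSpace ℝ (Fin 3) →L[ℝ] EuclideanSpace ℝ (Fin 3)}
    (hG : HasWeakSpatialGradientOn (slab (EuclideanSpace ℝ (Fin 3)) (Ioo 0 T) isOpen_Ioo) v G)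
    {φ : EuclideanSpace ℝ (Fin 3) → EuclideanSpace ℝ (Fin 3)}
    (hφ : FunctionSpaces.IsTestFunctionOn (⊤ : Opens (EuclideanSpace ℝ (Fin 3))) φ) :
    ∀ᵐ t ∂((volume : Measure ℝ).restrict (Ioo 0 T)),
      ∫ x, ⟪v t x, Δ φ x⟫ =
        -∫ x, ∑ i, ⟪G t x (stdOrthonormalBasis ℝ (EuclideanSpace ℝ (Fin 3)) i),
          fderiv ℝ φ x (stdOrthonormalBasis ℝ (EuclideanSpace ℝ (Fin 3)) i)⟫ := by
  set b := stdOrthonormalBasis ℝ (EuclideanSpace ℝ (Fin 3)) with hb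
  set K : Set (EuclideanSpace ℝ (Fin 3)) := tsupport φ with hK_def
  have hK : IsCompact K := hφ.hasCompactSupport
  have hφd : Differentiable ℝ φ := hφ.contDiff.differentiable (by simp)
  have hφ2 : ContDiff ℝ 2 φ := contDiff_infty.1 hφ.contDiff 2
  have cL : Continuous (Δ φ) := continuous_laplacian hφ2
  have cD : Continuous (fderiv ℝ φ) := hφ.contDiff.continuous_fderiv (by simp)
  have hL0 : ∀ x, x ∉ K → Δ φ x = 0 := fun x hx => laplacian_eq_zero_of_notMem_tsupport hx
  have hD0 : ∀ x, x ∉ K → fderiv ℝ φ x = 0 := fun x hx => fderiv_of_notMem_tsupport ℝ hx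
  -- the two sliced functions `A(t) = ∫ ⟪v t, Δφ⟫`, `B(t) = ∫ ∑ᵢ ⟪G t eᵢ, ∂ᵢφ⟫`
  obtain ⟨hvK1, -⟩ := h.integrableOn_velocity hK
  have iA : Integrable (fun z : ℝ × EuclideanSpace ℝ (Fin 3) => ⟪uncurry v z, Δ φ z.2⟫)
      (((volume : Measure ℝ).restrict (Ioo 0 T)).prod (volume : Measure (EuclideanSpace ℝ (Fin 3)))) :=
    integrable_slab_inner (Ψ := fun z : ℝ × EuclideanSpace ℝ (Fin 3) => Δ φ z.2) hK hvK1
      (cL.comp continuous_snd) fun t x hx => hL0 x hx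
  -- integrability of `G` on the finite cylinder `(0,T) × K` (weights vanish off `K`)
  have hslab : ((slab (EuclideanSpace ℝ (Fin 3)) (Ioo 0 T) isOpen_Ioo :
      Opens (ℝ × EuclideanSpace ℝ (Fin 3))) : Set (ℝ × EuclideanSpace ℝ (Fin 3))) =
      Ioo (0 : ℝ) T ×ˢ univ := rfl
  have hGm : AEStronglyMeasurable (uncurry G)
      (volume.restrict (Ioo (0 : ℝ) T ×ˢ (univ : Set (EuclideanSpace ℝ (Fin 3))))) := by
    rw [← hslab]; exact hG.locallyIntegrableOn_grad.aestronglyMeasurable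
  set Bf : ℝ × EuclideanSpace ℝ (Fin 3) → ℝ := fun z => ∑ i, ⟪G z.1 z.2 (b i), fderiv ℝ φ z.2 (b i)⟫
    with hBf
  have iB : Integrable Bf
      (((volume : Measure ℝ).restrict (Ioo 0 T)).prod (volume : Measure (EuclideanSpace ℝ (Fin 3)))) := by
    -- `G` is square integrable on `(0,T) × B` for a ball `B ⊇ K`, hence integrable there
    obtain ⟨G', hG', hG'b⟩ := h.uniformLocalGradient
    obtain ⟨r, hr⟩ := hK.isBounded.subset_ball (0 : EuclideanSpace ℝ (Fin 3))
    obtain ⟨C, hC⟩ := hG'b (max r 1) (lt_of_lt_of_le one_pos (le_max_right _ _))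
    have hKB : K ⊆ ball (0 : EuclideanSpace ℝ (Fin 3)) (max r 1) :=
      hr.trans (ball_subset_ball (le_max_left _ _))
    obtain ⟨Cφ, hCφ⟩ := cD.bounded_above_of_compact_support (hφ.hasCompactSupport.fderiv (𝕜 := ℝ))
    -- integrability on the cylinder `(0,T) × B`
    have hcyl : MeasurableSet (Ioo (0 : ℝ) T ×ˢ ball (0 : EuclideanSpace ℝ (Fin 3)) (max r 1)) :=
      measurableSet_Ioo.prod measurableSet_ball
    have hae : ∀ᵐ z ∂(volume.restrict (Ioo (0 : ℝ) T ×ˢ ball (0 : EuclideanSpace ℝ (Fin 3)) (max r 1))),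
        uncurry G z = uncurry G' z := by
      have h1 := hG.ae_eq hG'
      rw [hslab] at h1
      exact ae_restrict_of_ae_restrict_of_subset (prod_mono Subset.rfl (subset_univ _)) h1
    have hG2 : ∫⁻ z in Ioo (0 : ℝ) T ×ˢ ball (0 : EuclideanSpace ℝ (Fin 3)) (max r 1),
        ENNReal.ofReal (frobeniusNormSq (G z.1 z.2)) < ∞ := by
      have e : ∫⁻ z in Ioo (0 : ℝ) T ×ˢ ball (0 : EuclideanSpace ℝ (Fin 3)) (max r 1),
          ENNReal.ofReal (frobeniusNormSq (G z.1 z.2)) =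
          ∫⁻ z in Ioo (0 : ℝ) T ×ˢ ball (0 : EuclideanSpace ℝ (Fin 3)) (max r 1),
            ENNReal.ofReal (frobeniusNormSq (G' z.1 z.2)) := by
        refine lintegral_congr_ae ?_
        filter_upwards [hae] with z hz
        rw [show G z.1 z.2 = uncurry G z from rfl, hz]
        rfl
      rw [e]
      exact (hC 0).trans_lt ENNReal.coe_lt_top
    have hGi : ∀ i, IntegrableOn (fun z : ℝ × EuclideanSpace ℝ (Fin 3) => G z.1 z.2 (b i))
        (Ioo (0 : ℝ) T ×ˢ ball (0 : EuclideanSpace ℝ (Fin 3)) (max r 1)) volume := by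
      intro i
      haveI : IsFiniteMeasure (volume.restrict (Ioo (0 : ℝ) T ×ˢ ball (0 : EuclideanSpace ℝ (Fin 3)) (max r 1))) :=
        ⟨by rw [Measure.restrict_apply_univ, Measure.volume_eq_prod, Measure.prod_prod]
            exact ENNReal.mul_lt_top measure_Ioo_lt_top measure_ball_lt_top⟩
      have hm : AEStronglyMeasurable (fun z : ℝ × EuclideanSpace ℝ (Fin 3) => G z.1 z.2 (b i))
          (volume.restrict (Ioo (0 : ℝ) T ×ˢ ball (0 : EuclideanSpace ℝ (Fin 3)) (max r 1))) :=
        (hGm.mono_measure (Measure.restrict_mono (prod_mono Subset.rfl (subset_univ _)) le_rfl)).apply_continuousLinearMap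
          (b i)
      have hmem : MemLp (fun z : ℝ × EuclideanSpace ℝ (Fin 3) => G z.1 z.2 (b i)) 2
          (volume.restrict (Ioo (0 : ℝ) T ×ˢ ball (0 : EuclideanSpace ℝ (Fin 3)) (max r 1))) := by
        refine ⟨hm, ?_⟩
        rw [eLpNorm_lt_top_iff_lintegral_rpow_enorm_lt_top two_ne_zero ENNReal.ofNat_ne_top]
        simp only [ENNReal.toReal_ofNat, ENNReal.rpow_ofNat]
        refine lt_of_le_of_lt (lintegral_mono fun z => ?_) hG2
        rw [← ofReal_norm, ← ENNReal.ofReal_pow (norm_nonneg _)]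
        refine ENNReal.ofReal_le_ofReal ?_
        simp only [frobeniusNormSq, hb]
        exact Finset.single_le_sum (f := fun j => ‖G z.1 z.2 (stdOrthonormalBasis ℝ (EuclideanSpace ℝ (Fin 3)) j)‖ ^ 2)
          (fun j _ => sq_nonneg _) (Finset.mem_univ i)
      exact hmem.integrable one_le_two
    -- the weight `∂ᵢφ` is bounded and vanishes off `K`
    have hterm : ∀ i, Integrable (fun z : ℝ × EuclideanSpace ℝ (Fin 3) =>
        ⟪G z.1 z.2 (b i), fderiv ℝ φ z.2 (b i)⟫)
        (volume.restrict (Ioo (0 : ℝ) T ×ˢ (univ : Set (EuclideanSpace ℝ (Fin 3))))) := by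
      intro i
      have h1 : IntegrableOn (fun z : ℝ × EuclideanSpace ℝ (Fin 3) => ⟪G z.1 z.2 (b i), fderiv ℝ φ z.2 (b i)⟫)
          (Ioo (0 : ℝ) T ×ˢ ball (0 : EuclideanSpace ℝ (Fin 3)) (max r 1)) volume := by
        refine Integrable.mono' ((hGi i).norm.mul_const (Cφ * ‖b i‖))
          ((hGi i).aestronglyMeasurable.inner
            ((cD.comp continuous_snd).clm_apply continuous_const).aestronglyMeasurable)
          (Eventually.of_forall fun z => ?_)
        calc ‖⟪G z.1 z.2 (b i), fderiv ℝ φ z.2 (b i)⟫‖ ≤ ‖G z.1 z.2 (b i)‖ * ‖fderiv ℝ φ z.2 (b i)‖ :=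
              norm_inner_le_norm _ _
          _ ≤ ‖G z.1 z.2 (b i)‖ * (Cφ * ‖b i‖) := by
              gcongr
              exact (ContinuousLinearMap.le_opNorm _ _).trans
                (mul_le_mul_of_nonneg_right (hCφ z.2) (norm_nonneg _))
      refine h1.of_forall_sdiff_eq_zero (measurableSet_Ioo.prod MeasurableSet.univ) fun z hz => ?_
      have hz2 : z.2 ∉ K := fun hK' => hz.2 ⟨hz.1.1, hKB hK'⟩
      simp [hD0 z.2 hz2]
    have hsum : Integrable Bf (volume.restrict (Ioo (0 : ℝ) T ×ˢ (univ : Set (EuclideanSpace ℝ (Fin 3))))) := by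
      have e : Bf = fun z => ∑ i, ⟪G z.1 z.2 (b i), fderiv ℝ φ z.2 (b i)⟫ := rfl
      rw [e]
      exact integrable_finsetSum _ fun i _ => hterm i
    rwa [volume_restrict_slab_eq] at hsum
  set A : ℝ → ℝ := fun t => ∫ x, ⟪v t x, Δ φ x⟫ with hA
  set B : ℝ → ℝ := fun t => ∫ x, Bf (t, x) with hB
  have hAI : IntegrableOn A (Ioo 0 T) := iA.integral_prod_left
  have hBI : IntegrableOn B (Ioo 0 T) := iB.integral_prod_left
  -- the identity `∫ η (A + B) = 0` for `η ∈ C_c^∞((0,T))`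
  have key := IsOpen.ae_eq_zero_of_integral_contDiff_smul_eq_zero isOpen_Ioo
    (μ := (volume : Measure ℝ)) (f := fun t => A t + B t)
    (IntegrableOn.locallyIntegrableOn (hAI.add hBI)) ?_
  · rw [ae_restrict_iff' measurableSet_Ioo]
    filter_upwards [key] with t ht htI
    have h2 : A t + B t = 0 := ht htI
    simp only [hA, hB, hBf] at h2
    linarith
  intro η hη hηc hηI
  obtain ⟨Cη, hCη⟩ := hη.continuous.bounded_above_of_compact_support hηc
  have hC' : ∀ s, |η s| ≤ Cη := fun s => by simpa [Real.norm_eq_abs] using hCη s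
  have hΘ : IsSpaceTimeTestOn (slab (EuclideanSpace ℝ (Fin 3)) (Ioo 0 T) isOpen_Ioo)
      (fun s x => η s • φ x) := isSpaceTimeTestOn_slab_smul isOpen_Ioo hη hηc hηI hφ
  have hst := hG.integral_inner_laplacian_eq_neg_sum hΘ
  -- simplify the derivatives of `η(s) φ(x)`
  have hlap : ∀ s x, Δ (fun x => η s • φ x) x = η s • Δ φ x := fun s x =>
    laplacian_fun_const_smul hφ2 (η s) x
  have hgrad : ∀ s x i, fderiv ℝ (fun x => η s • φ x) x (b i) = η s • fderiv ℝ φ x (b i) := by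
    intro s x i
    rw [fderiv_fun_const_smul (hφd x)]
    rfl
  have e1 : (fun z : ℝ × EuclideanSpace ℝ (Fin 3) => ⟪v z.1 z.2, Δ (fun x => η z.1 • φ x) z.2⟫) =
      fun z => η z.1 * ⟪uncurry v z, Δ φ z.2⟫ := by
    funext z; rw [hlap, real_inner_smul_right]; rfl
  have e2 : (fun z : ℝ × EuclideanSpace ℝ (Fin 3) => ∑ i, ⟪G z.1 z.2 (b i),
      fderiv ℝ (fun x => η z.1 • φ x) z.2 (b i)⟫) = fun z => η z.1 * Bf z := by
    funext z
    simp only [hgrad, real_inner_smul_right, hBf, Finset.mul_sum]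
  rw [e1, e2] at hst
  -- both sides are integrals of integrable functions on the slab; Fubini
  have iA' : Integrable (fun z : ℝ × EuclideanSpace ℝ (Fin 3) => η z.1 * ⟪uncurry v z, Δ φ z.2⟫)
      (((volume : Measure ℝ).restrict (Ioo 0 T)).prod (volume : Measure (EuclideanSpace ℝ (Fin 3)))) :=
    integrable_time_mul iA hη.continuous hC'
  have iB' : Integrable (fun z : ℝ × EuclideanSpace ℝ (Fin 3) => η z.1 * Bf z)
      (((volume : Measure ℝ).restrict (Ioo 0 T)).prod (volume : Measure (EuclideanSpace ℝ (Fin 3)))) :=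
    integrable_time_mul iB hη.continuous hC'
  have hη0 : ∀ s, s ∉ Ioo (0 : ℝ) T → η s = 0 := fun s hs =>
    image_eq_zero_of_notMem_tsupport fun h' => hs (hηI h')
  have hzA : ∀ z : ℝ × EuclideanSpace ℝ (Fin 3), z ∉ Ioo (0 : ℝ) T ×ˢ (univ : Set (EuclideanSpace ℝ (Fin 3))) →
      η z.1 * ⟪uncurry v z, Δ φ z.2⟫ = 0 := fun z hz => by
    rw [hη0 z.1 (fun h' => hz ⟨h', mem_univ _⟩), zero_mul]
  have hzB : ∀ z : ℝ × EuclideanSpace ℝ (Fin 3), z ∉ Ioo (0 : ℝ) T ×ˢ (univ : Set (EuclideanSpace ℝ (Fin 3))) →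
      η z.1 * Bf z = 0 := fun z hz => by
    rw [hη0 z.1 (fun h' => hz ⟨h', mem_univ _⟩), zero_mul]
  have hLHS : ∫ z : ℝ × EuclideanSpace ℝ (Fin 3), η z.1 * ⟪uncurry v z, Δ φ z.2⟫ =
      ∫ s in Ioo 0 T, η s * A s := by
    rw [← setIntegral_eq_integral_of_forall_compl_eq_zero hzA, volume_restrict_slab_eq,
      integral_prod _ iA']
    refine setIntegral_congr_fun measurableSet_Ioo fun s _ => ?_
    simp only [hA, uncurry, ← integral_const_mul]
  have hRHS : ∫ z : ℝ × EuclideanSpace ℝ (Fin 3), η z.1 * Bf z = ∫ s in Ioo 0 T, η s * B s := by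
    rw [← setIntegral_eq_integral_of_forall_compl_eq_zero hzB, volume_restrict_slab_eq,
      integral_prod _ iB']
    refine setIntegral_congr_fun measurableSet_Ioo fun s _ => ?_
    simp only [hB, ← integral_const_mul]
  rw [hLHS, hRHS] at hst
  -- `∫ η A = -∫ η B` on `(0,T)`; outside `(0,T)` the integrand vanishes
  have hAint : IntegrableOn (fun s => η s * A s) (Ioo 0 T) := by
    refine Integrable.mono' (hAI.norm.const_mul Cη) (hη.continuous.aestronglyMeasurable.restrict.mul hAI.1) ?_
    filter_upwards with s
    rw [norm_mul]
    exact mul_le_mul_of_nonneg_right (by simpa using hCη s) (norm_nonneg _)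
  have hBint : IntegrableOn (fun s => η s * B s) (Ioo 0 T) := by
    refine Integrable.mono' (hBI.norm.const_mul Cη) (hη.continuous.aestronglyMeasurable.restrict.mul hBI.1) ?_
    filter_upwards with s
    rw [norm_mul]
    exact mul_le_mul_of_nonneg_right (by simpa using hCη s) (norm_nonneg _)
  rw [← setIntegral_eq_integral_of_forall_compl_eq_zero (s := Ioo 0 T) (fun s hs => by
    rw [hη0 s hs, zero_smul])]
  simp only [smul_eq_mul, mul_add]
  rw [integral_add hAint hBint, hst]
  ring


/-- **The pairing identity from the initial time, with the viscous term in gradient form**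
(Lemarié-Rieusset 2016, Prop. 14.1 and proof of Thm. 14.7, p. 515: `∂ₜ∫u·φ = -ν∫∇u·∇φ + …`; the
form of `ae_pairing_eq_datum_add` that extends to `H¹` test fields). For a local Leray solution
`(v, π)` on `(0,T) × ℝ³`, `T > 0`, with measurable datum `v₀`, a weak spatial gradient `G` of `v`
on the slab, every `φ ∈ C_c^∞(ℝ³; ℝ³)` and a.e. `t ∈ (0,T)`:
`∫ ⟪v(t), φ⟫ = ∫ ⟪v₀, φ⟫ + ∫_{(0,t]} ( ∫ (⟪v, (v·∇)φ⟫ + π div φ) - ν ∫ ∑ᵢ ⟪G eᵢ, ∂ᵢφ⟫ )`.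
[cite: LemarieRieusset2016, Prop. 14.1 (file p. 498) and Thm. 14.7 proof (p. 515)] -/
theorem ae_pairing_eq_datum_add_grad (h : IsLocalLeraySolutionOn T ν v₀ v π) (hT : 0 < T)
    (hm₀ : AEStronglyMeasurable v₀ volume)
    {G : ℝ → EuclideanSpace ℝ (Fin 3) → EuclideanSpace ℝ (Fin 3) →L[ℝ] EuclideanSpace ℝ (Fin 3)}
    (hG : HasWeakSpatialGradientOn (slab (EuclideanSpace ℝ (Fin 3)) (Ioo 0 T) isOpen_Ioo) v G)
    {φ : EuclideanSpace ℝ (Fin 3) → EuclideanSpace ℝ (Fin 3)}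
    (hφ : FunctionSpaces.IsTestFunctionOn (⊤ : Opens (EuclideanSpace ℝ (Fin 3))) φ) :
    ∀ᵐ t ∂((volume : Measure ℝ).restrict (Ioo 0 T)),
      ∫ x, ⟪v t x, φ x⟫ = (∫ x, ⟪v₀ x, φ x⟫) +
        ∫ s in Ioc 0 t, ((∫ x, (⟪v s x, convect (v s) φ x⟫ + π s x * VectorCalculus.divergence φ x)) -
          ν * ∫ x, ∑ i, ⟪G s x (stdOrthonormalBasis ℝ (EuclideanSpace ℝ (Fin 3)) i),
            fderiv ℝ φ x (stdOrthonormalBasis ℝ (EuclideanSpace ℝ (Fin 3)) i)⟫) := by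
  set b := stdOrthonormalBasis ℝ (EuclideanSpace ℝ (Fin 3)) with hb
  set K : Set (EuclideanSpace ℝ (Fin 3)) := tsupport φ with hK_def
  have hK : IsCompact K := hφ.hasCompactSupport
  have hφd : Differentiable ℝ φ := hφ.contDiff.differentiable (by simp)
  have hφ2 : ContDiff ℝ 2 φ := contDiff_infty.1 hφ.contDiff 2
  have cD : Continuous (fderiv ℝ φ) := hφ.contDiff.continuous_fderiv (by simp)
  have cL : Continuous (Δ φ) := continuous_laplacian hφ2
  have cdiv : Continuous (VectorCalculus.divergence φ) := by
    have : VectorCalculus.divergence φ = fun x => ∑ i, ⟪stdOrthonormalBasis ℝ (EuclideanSpace ℝ (Fin 3)) i,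
        fderiv ℝ φ x (stdOrthonormalBasis ℝ (EuclideanSpace ℝ (Fin 3)) i)⟫ := by
      funext x
      exact divergence_eq_sum_inner_fderiv (stdOrthonormalBasis ℝ (EuclideanSpace ℝ (Fin 3))) φ x
    rw [this]
    exact continuous_finsetSum _ fun i _ => continuous_const.inner (cD.clm_apply continuous_const)
  have hD0 : ∀ x, x ∉ K → fderiv ℝ φ x = 0 := fun x hx => fderiv_of_notMem_tsupport ℝ hx
  have hL0 : ∀ x, x ∉ K → Δ φ x = 0 := fun x hx => laplacian_eq_zero_of_notMem_tsupport hx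
  have hdiv0 : ∀ x, x ∉ K → VectorCalculus.divergence φ x = 0 := fun x hx => by
    simp [VectorCalculus.divergence, hD0 x hx]
  -- product integrability of the three slice integrands
  obtain ⟨hUK1, hUK2⟩ := h.integrableOn_velocity hK
  have iX : Integrable (fun z : ℝ × EuclideanSpace ℝ (Fin 3) => ⟪v z.1 z.2, convect (v z.1) φ z.2⟫)
      (((volume : Measure ℝ).restrict (Ioo 0 T)).prod (volume : Measure (EuclideanSpace ℝ (Fin 3)))) :=
    integrable_slab_inner_clm_apply (A := fun z : ℝ × EuclideanSpace ℝ (Fin 3) => fderiv ℝ φ z.2) hK hUK1 hUK2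
      (cD.comp continuous_snd) fun t x hx => hD0 x hx
  have iY : Integrable (fun z : ℝ × EuclideanSpace ℝ (Fin 3) => ⟪v z.1 z.2, Δ φ z.2⟫)
      (((volume : Measure ℝ).restrict (Ioo 0 T)).prod (volume : Measure (EuclideanSpace ℝ (Fin 3)))) :=
    integrable_slab_inner (Ψ := fun z : ℝ × EuclideanSpace ℝ (Fin 3) => Δ φ z.2) hK hUK1 (cL.comp continuous_snd)
      fun t x hx => hL0 x hx
  have iP : Integrable (fun z : ℝ × EuclideanSpace ℝ (Fin 3) => π z.1 z.2 * VectorCalculus.divergence φ z.2)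
      (((volume : Measure ℝ).restrict (Ioo 0 T)).prod (volume : Measure (EuclideanSpace ℝ (Fin 3)))) :=
    integrable_slab_mul (g := fun z : ℝ × EuclideanSpace ℝ (Fin 3) => VectorCalculus.divergence φ z.2) hK
      (h.integrableOn_pressure hK) (cdiv.comp continuous_snd) fun t x hx => hdiv0 x hx
  have hsX : ∀ᵐ s ∂((volume : Measure ℝ).restrict (Ioo 0 T)),
      Integrable (fun x => ⟪v s x, convect (v s) φ x⟫) (volume : Measure (EuclideanSpace ℝ (Fin 3))) :=
    iX.prod_right_ae
  have hsY : ∀ᵐ s ∂((volume : Measure ℝ).restrict (Ioo 0 T)),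
      Integrable (fun x => ⟪v s x, Δ φ x⟫) (volume : Measure (EuclideanSpace ℝ (Fin 3))) :=
    iY.prod_right_ae
  have hsP : ∀ᵐ s ∂((volume : Measure ℝ).restrict (Ioo 0 T)),
      Integrable (fun x => π s x * VectorCalculus.divergence φ x) (volume : Measure (EuclideanSpace ℝ (Fin 3))) :=
    iP.prod_right_ae
  -- the a.e. identity of the slice integrands
  have hsplit : ∀ᵐ s ∂((volume : Measure ℝ).restrict (Ioo 0 T)),
      ∫ x, (⟪v s x, convect (v s) φ x⟫ + ν * ⟪v s x, Δ φ x⟫ + π s x * VectorCalculus.divergence φ x) =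
        (∫ x, (⟪v s x, convect (v s) φ x⟫ + π s x * VectorCalculus.divergence φ x)) -
          ν * ∫ x, ∑ i, ⟪G s x (b i), fderiv ℝ φ x (b i)⟫ := by
    filter_upwards [hsX, hsY, hsP, h.ae_integral_inner_laplacian_slice hG hφ] with s hX hY hP hlap
    have e1 : (fun x => ⟪v s x, convect (v s) φ x⟫ + ν * ⟪v s x, Δ φ x⟫ +
        π s x * VectorCalculus.divergence φ x) =
        fun x => (⟪v s x, convect (v s) φ x⟫ + π s x * VectorCalculus.divergence φ x) +
          ν * ⟪v s x, Δ φ x⟫ := by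
      funext x; ring
    have hXP : Integrable (fun x => ⟪v s x, convect (v s) φ x⟫ + π s x * VectorCalculus.divergence φ x)
        (volume : Measure (EuclideanSpace ℝ (Fin 3))) := hX.add hP
    have hνY : Integrable (fun x => ν * ⟪v s x, Δ φ x⟫) (volume : Measure (EuclideanSpace ℝ (Fin 3))) :=
      hY.const_mul ν
    rw [e1, integral_add hXP hνY, integral_const_mul, hlap]
    ring
  have hsplit' := (ae_restrict_iff' measurableSet_Ioo).1 hsplit
  filter_upwards [h.ae_pairing_eq_datum_add hT hm₀ hφ, ae_restrict_mem measurableSet_Ioo]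
    with t ht htI
  rw [ht]
  congr 1
  refine setIntegral_congr_ae measurableSet_Ioc ?_
  filter_upwards [hsplit'] with s hs hsI
  exact hs ⟨hsI.1, lt_of_le_of_lt hsI.2 htI.2⟩

end IsLocalLeraySolutionOn

end Literature.Analysis.FluidPDE
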